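import Summits.ResolutionOfSingularities.ResolutionOfSingularities.Theorems.FrobeniusClosingPatchingRelPerfectConeDepthTwoCharts
import HarnessLib

/-!
# Crux `PatchingRelPerfect` (stmt-ResolutionOfSingularities-16161), chain w52 — the
# CONTACT-MIGRATION member `I = (x₀x₁ + x₂² + x₃³) + 𝔪⁴`: level-one chart ideals

[OURS · L1 W5.2 · rung] Kernel sentence (iii) at exceptional depth two over the quadric cone
`q = x₀x₁ + x₂²`: the one NON-permissible tilt direction `f = q + x₃³` (this seat's
HAND-NOTE-nongraded-A2.md: the contact of the strict transform with the exceptional divisor migrates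
to the vertex; PLAN-A2-certificate.md addenda 3–4: companion
`Q₀ = A₀₂ · A₁₀ · A₁₁ · A₁₂ · (P + 𝔪²)`, `A_{k,m} = (f) + J_{k,m}`, `J₂₀ = 𝔪⁴` (`I = A₂₀`),
`J₁₀ = 𝔪³`, `J₀₂ = (P + 𝔪²)²`, `J₁₁ = 𝔪² (P + 𝔪²)`, `J₁₂ = 𝔪 (P + 𝔪²)²`, `P = (x₀, x₁, x₂)`).
PROVED here, uniformly on the four Rees charts `B_i = S[x/x_i]` of `Bl_𝔪` (`u = x_i`, `e_j = x_j/x_i`,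
`F♯ = e₀e₁ + e₂² + u e₃³`, `N₀ = (u, e₀, e₁, e₂)`; any commutative `S`):

* `chartBase_qCube` — `φ(f) = u² F♯`;
* `map_chartBase_A20/A10/A02/A11/A12` — `A_{k,m} B_i = u² · ((F♯) + uᵏ N₀ᵐ)` in the five cases;
* `map_chartBase_cubeIQ` — `(I·Q₀) B_i = u¹¹ · [((F♯)+(u²)) ((F♯)+N₀²) ((F♯)+(u)) ((F♯)+u N₀) ((F♯)+u N₀²)] · N₀`;
* `map_chartBase_cubeIQ_of_ne_three` — on `i ≤ 2` (`N₀ = (1)`):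
  `= u¹¹ · ∏_{s<4} (F♯, L₀⋯L_s)` with letters `L = (u, 1, 1, u)` (input of `…LetterTowerTwo`);
* `cube_companion_bound` — `𝔪¹⁸ ≤ Q₀`.

Nothing here is a statement of the manuscript under review.

## References

* The Stacks Project, Tag 0804 (affine blow-up algebras and their charts). [StacksProject]
* U. Görtz, T. Wedhorn, *Algebraic Geometry I*, 2nd ed. 2020, Prop. 13.91 (2), (13.19). [GortzWedhorn2020]
-/

-- `Summit.<Summit>.<Sub>.Theorems` with `Sub = Summit` (single-conjunct summit, D-0017)
set_option linter.dupNamespace false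

noncomputable section

open CategoryTheory CategoryTheory.Limits AlgebraicGeometry Literature.AlgebraicGeometry.Resolution
open IsLocalRing

namespace Summit.ResolutionOfSingularities.ResolutionOfSingularities.Theorems

namespace ConeRung

universe u

/-- The flag of the letter word `(a, 1, 1, a)`: `∏_{s<4} (c, L₀⋯L_s) = (c, a)³ · ((c) + (a)²)` —
generic commutative semiring. [folklore] -/
theorem flag_four_eq {B : Type*} [CommSemiring B] (c a : B) :
    ∏ s ∈ Finset.range 4, Ideal.span {c, ∏ r ∈ Finset.range (s + 1), [a, 1, 1, a].getD r 1} =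
      (Ideal.span {c} ⊔ Ideal.span {a} ^ 2) * (Ideal.span {c} ⊔ Ideal.span {a}) *
        (Ideal.span {c} ⊔ Ideal.span {a}) * (Ideal.span {c} ⊔ Ideal.span {a}) := by
  simp only [Finset.prod_range_succ, Finset.prod_range_zero, List.getD_cons_zero,
    List.getD_cons_succ, one_mul, mul_one, Ideal.span_insert]
  rw [Ideal.span_singleton_pow, sq]
  ring

section LevelOne

variable {S : Type u} [CommRing S] (x : Fin 4 → S) (i : Fin 4)

local notation3 "M" => Ideal.span (Set.range x)
local notation3 "PP" => Ideal.span {x 0, x 1, x 2}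
local notation3 "fC" => x 0 * x 1 + x 2 ^ 2 + x 3 ^ 3
local notation3 "φ" => chartBase x i
local notation3 "u" => chartBase x i (x i)
local notation3 "e[" j "]" => chartGen x i j
local notation3 "Fs" => chartGen x i 0 * chartGen x i 1 + chartGen x i 2 ^ 2 +
  chartBase x i (x i) * chartGen x i 3 ^ 3
local notation3 "U" => Ideal.span {chartBase x i (x i)}
local notation3 "N0" => Ideal.span {chartBase x i (x i), chartGen x i 0, chartGen x i 1, chartGen x i 2}

/-- **`φ(f) = u² · F♯`**, `F♯ = e₀e₁ + e₂² + u e₃³`, on every chart. [folklore] -/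
theorem chartBase_qCube : φ fC = u ^ 2 * Fs := by
  rw [map_add, chartBase_q, map_pow, reesChartBase_apply_eq_mul_chartGen x i 3]
  ring

/-- `(f) B_i = u² (F♯)`. [folklore] -/
theorem map_chartBase_span_fC : (Ideal.span {fC}).map φ = U ^ 2 * Ideal.span {Fs} := by
  rw [Ideal.map_span, Set.image_singleton, chartBase_qCube, span_pow_mul]

/-- **`I B_i = A₂₀ B_i = u² · ((F♯) + (u)²)`**. [folklore] -/
theorem map_chartBase_A20 :
    (Ideal.span {fC} ⊔ M ^ 4).map φ = U ^ 2 * (Ideal.span {Fs} ⊔ U ^ 2) := by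
  rw [Ideal.map_sup, Ideal.map_pow, map_chartBase_M, map_chartBase_span_fC, Ideal.mul_sup,
    ← pow_add]

/-- **`A₁₀ B_i = u² · ((F♯) + (u))`**. [folklore] -/
theorem map_chartBase_A10 :
    (Ideal.span {fC} ⊔ M ^ 3).map φ = U ^ 2 * (Ideal.span {Fs} ⊔ U) := by
  rw [Ideal.map_sup, Ideal.map_pow, map_chartBase_M, map_chartBase_span_fC, Ideal.mul_sup,
    ← pow_succ]

/-- **`A₀₂ B_i = u² · ((F♯) + N₀²)`**. [folklore] -/
theorem map_chartBase_A02 :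
    (Ideal.span {fC} ⊔ (PP ⊔ M ^ 2) ^ 2).map φ = U ^ 2 * (Ideal.span {Fs} ⊔ N0 ^ 2) := by
  rw [Ideal.map_sup, Ideal.map_pow, map_chartBase_PM, map_chartBase_span_fC, Ideal.mul_sup,
    mul_pow]

/-- **`A₁₁ B_i = u² · ((F♯) + u N₀)`**. [folklore] -/
theorem map_chartBase_A11 :
    (Ideal.span {fC} ⊔ M ^ 2 * (PP ⊔ M ^ 2)).map φ = U ^ 2 * (Ideal.span {Fs} ⊔ U * N0) := by
  rw [Ideal.map_sup, Ideal.map_mul, Ideal.map_pow, map_chartBase_M, map_chartBase_PM,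
    map_chartBase_span_fC, Ideal.mul_sup, ← mul_assoc, ← pow_succ]

/-- **`A₁₂ B_i = u² · ((F♯) + u N₀²)`**. [folklore] -/
theorem map_chartBase_A12 :
    (Ideal.span {fC} ⊔ M * (PP ⊔ M ^ 2) ^ 2).map φ = U ^ 2 * (Ideal.span {Fs} ⊔ U * N0 ^ 2) := by
  rw [Ideal.map_sup, Ideal.map_mul, Ideal.map_pow, map_chartBase_M, map_chartBase_PM,
    map_chartBase_span_fC, Ideal.mul_sup, mul_pow, ← mul_assoc, ← pow_succ']
  ring_nf

/-- **The total transform of `I · Q₀`**, `Q₀ = A₀₂ A₁₀ A₁₁ A₁₂ (P + 𝔪²)`, on every chart: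
`u¹¹ · [((F♯)+(u)²) ((F♯)+N₀²) ((F♯)+(u)) ((F♯)+u N₀) ((F♯)+u N₀²)] · N₀`. [folklore] -/
theorem map_chartBase_cubeIQ :
    ((Ideal.span {fC} ⊔ M ^ 4) * ((Ideal.span {fC} ⊔ (PP ⊔ M ^ 2) ^ 2) *
      (Ideal.span {fC} ⊔ M ^ 3) * (Ideal.span {fC} ⊔ M ^ 2 * (PP ⊔ M ^ 2)) *
      (Ideal.span {fC} ⊔ M * (PP ⊔ M ^ 2) ^ 2) * (PP ⊔ M ^ 2))).map φ =
      Ideal.span {u ^ 11} *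
        (((Ideal.span {Fs} ⊔ U ^ 2) * (Ideal.span {Fs} ⊔ N0 ^ 2) * (Ideal.span {Fs} ⊔ U) *
          (Ideal.span {Fs} ⊔ U * N0) * (Ideal.span {Fs} ⊔ U * N0 ^ 2)) * N0) := by
  rw [Ideal.map_mul, Ideal.map_mul, Ideal.map_mul, Ideal.map_mul, Ideal.map_mul,
    map_chartBase_A20, map_chartBase_A02, map_chartBase_A10, map_chartBase_A11, map_chartBase_A12,
    map_chartBase_PM, ← Ideal.span_singleton_pow]
  ring

/-- The letter word `(u, 1, 1, u, 1, 1, …)` of the side charts takes values in `{u, 1}`. [folklore] -/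
theorem cube_letters_spec (r : ℕ) : [u, 1, 1, u].getD r 1 = u ∨ [u, 1, 1, u].getD r 1 = 1 := by
  rcases r with _ | _ | _ | _ | r <;> simp

/-- **On the charts `i = 0, 1, 2`** (`N₀ = (1)`): `(I·Q₀) B_i = u¹¹ · ∏_{s<4} (F♯, L₀⋯L_s)` with the
letters `L = (u, 1, 1, u)` — the flag `(F♯,u)(F♯,u)(F♯,u)(F♯,u²)` of `…LetterTowerTwo`. [folklore] -/
theorem map_chartBase_cubeIQ_of_ne_three (hi : i ≠ 3) :
    ((Ideal.span {fC} ⊔ M ^ 4) * ((Ideal.span {fC} ⊔ (PP ⊔ M ^ 2) ^ 2) *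
      (Ideal.span {fC} ⊔ M ^ 3) * (Ideal.span {fC} ⊔ M ^ 2 * (PP ⊔ M ^ 2)) *
      (Ideal.span {fC} ⊔ M * (PP ⊔ M ^ 2) ^ 2) * (PP ⊔ M ^ 2))).map φ =
      Ideal.span {u ^ 11} *
        ∏ s ∈ Finset.range 4, Ideal.span {Fs, ∏ r ∈ Finset.range (s + 1), [u, 1, 1, u].getD r 1} := by
  rw [map_chartBase_cubeIQ, span_u_e_eq_top_of_ne_three x i hi]
  simp only [Ideal.top_pow, sup_top_eq, Ideal.mul_top]
  congr 1
  exact (flag_four_eq Fs u).symm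

/-- **The companion bound**: `𝔪¹⁸ ≤ Q₀ = A₀₂ A₁₀ A₁₁ A₁₂ (P + 𝔪²)` (`4 + 3 + 4 + 5 + 2`). [folklore] -/
theorem cube_companion_bound :
    M ^ 18 ≤ (Ideal.span {fC} ⊔ (PP ⊔ M ^ 2) ^ 2) * (Ideal.span {fC} ⊔ M ^ 3) *
      (Ideal.span {fC} ⊔ M ^ 2 * (PP ⊔ M ^ 2)) * (Ideal.span {fC} ⊔ M * (PP ⊔ M ^ 2) ^ 2) *
      (PP ⊔ M ^ 2) := by
  have h2 : M ^ 2 ≤ PP ⊔ M ^ 2 := le_sup_right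
  have e : M ^ 18 = M ^ 4 * M ^ 3 * M ^ 4 * M ^ 5 * M ^ 2 := by ring
  have e4 : M ^ 4 = M ^ 2 * M ^ 2 := by rw [← pow_add]
  have e5 : M ^ 5 = M * (M ^ 2 * M ^ 2) := by rw [← pow_add, ← pow_succ']
  rw [e]
  refine Ideal.mul_mono (Ideal.mul_mono (Ideal.mul_mono (Ideal.mul_mono ?_ le_sup_right) ?_) ?_) h2
  · refine le_sup_of_le_right ?_
    rw [e4, pow_two (PP ⊔ M ^ 2)]
    exact Ideal.mul_mono h2 h2
  · refine le_sup_of_le_right ?_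
    rw [e4]
    exact Ideal.mul_mono_right h2
  · refine le_sup_of_le_right ?_
    rw [e5, pow_two (PP ⊔ M ^ 2)]
    exact Ideal.mul_mono_right (Ideal.mul_mono h2 h2)

end LevelOne

end ConeRung

end Summit.ResolutionOfSingularities.ResolutionOfSingularities.Theorems

end
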